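/-
COR-CM (cell pub-hodgecm2, stage 2 of the Hodge ladder) — count-neutral KERNEL COMBINATORICS «the index-two cyclic law», part XXIV: THE MIXED TWISTS,
V — EVERY TWIST AT LEVEL `n = 2·pᵏ` (seat prover-pub-hodgecm2-b23-g56-0, binder prover b23, gen 56; claim «INDEX-TWO CYCLIC — THE MIXED TWISTS»,
HOME/INBOX.md l.26438).  Theorems only, on parts XX–XXII BY NAME; no definition, no `decide`, no certificate, no named fact, no `sorry`; `Interfaces.lean`
(C1), every E term, B01, `Transposition/*`, `PortJoin/*`, `D2Bridge/*` untouched.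
HONEST FRAMING: `HC_CM` is NOT proved, here or anywhere in the tree; nothing here is a period, a count of record or a headline.
T5: n/a-class (hypothesis binders = the fields of `IndexTwoCyclic.Datum`, `c·c = 1`, `c ≠ 1`, `p` prime, `n = 2·pᵏ`; inhabited by part XXIIIʼs
`SplitGroup (2·3) 7`; checker: self).
-/
import Summits.HodgeConjecture.CorCM.Census.IndexTwoCyclicMixedInstance

/-!
# The index-two cyclic law, XXIV: the mixed twists, V — every twist at level `n = 2·pᵏ`

At level `n = 2pᵏ` (`p` prime; for odd `p`, `|G| = 8pᵏ`; for `p = 2` this is part XIʼs 2-power level again) the mixed side is automatically at the octic level: `j = orderOf u^{r+1}` is an odd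
divisor of `2pᵏ`, so `j = pⁱ`; if `0 < i < k` then the element `u^{2n/p}` of order `p` would lie in both `⟨uʲ⟩` (as `j ∣ 2n/p`) and `⟨v⟩` (by
Bézout, `u^{gcd(r+1, 2n)} = u^{2n/j} ∈ ⟨v⟩` and `2n/j ∣ 2n/p`), contradicting part XXʼs `⟨uʲ⟩ ∩ ⟨v⟩ = 1`.  Hence `j ∈ {1, pᵏ}`: dihedral or octic.

* `orderOf_twist_eq_of_prime_pow`: `c ∉ ⟨v⟩`, `v ≠ 1`, `n = 2pᵏ` ⟹ `orderOf v = pᵏ`;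
* **`isLeast_card_gfaces_generate_fibreTwo_of_two_mul_prime_pow`: `μ(G, c) = φ₂(G, c)` for EVERY split index-two cyclic datum of level `n = 2pᵏ`,
  whatever the twist** (`p` any prime; `ℤ/4pᵏ × ℤ/2`-type, `D(ℤ/4pᵏ)`, `D₄ × C_{pᵏ}`, and the `d₂ = 1` twists); block currency `β − (1 if c ∈ ⟨v⟩ else 2)`; structure-free
  form `…_of_involution_two_mul_prime_pow`.  (At the group level `|G| = 8pᵏ` with an element of order `4pᵏ` this is also seat b23 gen 52ʼs
  Sylow-transfer law XII; here it is read inside the index-two cyclic column, closing it at these levels.)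

## References
* [Pohlmann1968] H. Pohlmann, Algebraic cycles on abelian varieties of complex multiplication type, Ann. of Math. 88 (1968), Thm 1.
* [Milne1999] J. S. Milne, Lefschetz motives and the Tate conjecture, Compositio Math. 117 (1999), Prop. 2.1, p. 54.
-/

namespace Summit.HodgeConjecture.CorCM.Census.IndexTwoCyclic

open Finset
open Summit.HodgeConjecture.CorCM.Prior.AllgGroup.RfwfAllgGroup
open Summit.HodgeConjecture.CorCM.Census.BlockParity
open Summit.HodgeConjecture.CorCM.Census.Coinvariant

noncomputable section

variable {G : Type*} [Group G] [Fintype G] [DecidableEq G] {c : G} {n : ℕ} [NeZero n]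
variable (D : Datum G c n)

/-! ## §1 Bézout: `u^{gcd(r+1, 2n)} ∈ ⟨v⟩` -/

omit [Fintype G] [DecidableEq G] [NeZero n] in
/-- **`u^{gcd(r+1, 2n)} ∈ ⟨u^{r+1}⟩`** (Bézout). [folklore] -/
theorem pow_gcd_mem_zpowers_twist : D.u ^ Nat.gcd (D.r + 1) (2 * n) ∈ Subgroup.zpowers (D.u ^ (D.r + 1)) := by
  set d := Nat.gcd (D.r + 1) (2 * n) with hd
  rw [Subgroup.mem_zpowers_iff]
  refine ⟨Nat.gcdA (D.r + 1) (2 * n), ?_⟩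
  have hbez : ((d : ℕ) : ℤ) = ((D.r + 1 : ℕ) : ℤ) * Nat.gcdA (D.r + 1) (2 * n) + ((2 * n : ℕ) : ℤ) * Nat.gcdB (D.r + 1) (2 * n) :=
    Nat.gcd_eq_gcd_ab (D.r + 1) (2 * n)
  have e : D.u ^ ((d : ℕ) : ℤ) = (D.u ^ (D.r + 1)) ^ Nat.gcdA (D.r + 1) (2 * n) := by
    rw [hbez, zpow_add, zpow_mul, zpow_mul, zpow_natCast, zpow_natCast, D.pow_two_mul, one_zpow, mul_one]
  rw [zpow_natCast] at e
  exact e.symm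

omit [Fintype G] [DecidableEq G] [NeZero n] in
/-- `gcd(r+1, 2n) · orderOf v = 2n`. [folklore] -/
theorem gcd_mul_orderOf_twist : Nat.gcd (D.r + 1) (2 * n) * orderOf (D.u ^ (D.r + 1)) = 2 * n := by
  rw [orderOf_twist_eq_div_gcd D, Nat.gcd_comm (D.r + 1) (2 * n)]
  exact Nat.mul_div_cancel' (Nat.gcd_dvd_left (2 * n) (D.r + 1))

omit [DecidableEq G] [NeZero n] in
/-- **`u^{2n/j} ∈ ⟨v⟩`** (`j = orderOf v`; `2n/j = gcd(r+1, 2n)`). [folklore] -/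
theorem pow_div_orderOf_twist_mem_zpowers_twist : D.u ^ (2 * n / orderOf (D.u ^ (D.r + 1))) ∈ Subgroup.zpowers (D.u ^ (D.r + 1)) := by
  have e : 2 * n / orderOf (D.u ^ (D.r + 1)) = Nat.gcd (D.r + 1) (2 * n) :=
    Nat.div_eq_of_eq_mul_left (orderOf_pos _) (gcd_mul_orderOf_twist D).symm
  rw [e]
  exact pow_gcd_mem_zpowers_twist D

/-! ## §2 At level `n = 2pᵏ` the mixed side is octic -/

omit [DecidableEq G] [NeZero n] in
/-- **At level `n = 2pᵏ` a mixed twist has `orderOf u^{r+1} = pᵏ`.** [folklore] -/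
theorem orderOf_twist_eq_of_prime_pow {p k : ℕ} (hp : p.Prime) (hn : n = 2 * p ^ k)
    (h : c ∉ Subgroup.zpowers (D.u ^ (D.r + 1))) (hv : D.u ^ (D.r + 1) ≠ 1) : orderOf (D.u ^ (D.r + 1)) = p ^ k := by
  set v := D.u ^ (D.r + 1) with hvdef
  set j := orderOf v with hjdef
  haveI := Fact.mk hp
  have hodd : Odd j := odd_orderOf_twist D h
  -- `j ∣ pᵏ`
  have hjn : j ∣ n := orderOf_twist_dvd_n D h
  have hjpk : j ∣ p ^ k := by
    rw [hn] at hjn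
    exact hodd.coprime_two_right.dvd_of_dvd_mul_left hjn
  obtain ⟨i, hik, hji⟩ := (Nat.dvd_prime_pow hp).mp hjpk
  -- `i ≠ 0`
  have hi0 : i ≠ 0 := by
    rintro rfl
    rw [pow_zero] at hji
    exact hv (orderOf_eq_one_iff.mp hji)
  -- if `i < k`: the element `u^{2n/p}` of `⟨uʲ⟩ ∩ ⟨v⟩` is non-trivial
  rcases Nat.lt_or_ge i k with hlt | hge
  · exfalso
    have hp0 : 0 < p := hp.pos
    -- `2n/p = 4 p^{k-1}`; `j = pⁱ ∣ 2n/p` and `2n/j ∣ 2n/p`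
    obtain ⟨k', rfl⟩ : ∃ k', k = k' + 1 := ⟨k - 1, by omega⟩
    have h2n : 2 * n = (2 * 2 * p ^ k') * p := by rw [hn, pow_succ]; ring
    have hx_j : D.u ^ (2 * 2 * p ^ k') ∈ Subgroup.zpowers (D.u ^ j) := by
      -- `j = pⁱ ∣ p^{k'}` since `i ≤ k'`
      obtain ⟨q, hq⟩ : j ∣ 2 * 2 * p ^ k' := by
        rw [hji]; exact Dvd.dvd.mul_left (pow_dvd_pow p (by omega)) _
      rw [hq, pow_mul]
      exact Subgroup.pow_mem _ (Subgroup.mem_zpowers _) q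
    have hx_v : D.u ^ (2 * 2 * p ^ k') ∈ Subgroup.zpowers v := by
      -- `2n/j ∣ 2·2·p^{k'}` since `p ∣ j`: `j · (2n/j) = 2n = (2·2·p^{k'})·p`
      have hdiv : 2 * n / j ∣ 2 * 2 * p ^ k' := by
        obtain ⟨q, hq⟩ : p ∣ j := by rw [hji]; exact dvd_pow_self p hi0
        have hmul : j * (2 * n / j) = 2 * n := Nat.mul_div_cancel' (orderOf_twist_dvd D)
        rw [hq] at hmul
        have hmul' : p * (q * (2 * n / (p * q))) = p * (2 * 2 * p ^ k') := by
          rw [← mul_assoc, hmul, h2n]; ring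
        have hcancel := Nat.eq_of_mul_eq_mul_left hp0 hmul'
        rw [← hq] at hcancel
        exact Dvd.intro_left q hcancel
      obtain ⟨q, hq⟩ := hdiv
      rw [hq, pow_mul]
      exact Subgroup.pow_mem _ (pow_div_orderOf_twist_mem_zpowers_twist D) q
    have hx1 : D.u ^ (2 * 2 * p ^ k') = 1 := eq_one_of_mem_zpowers_of_mem_zpowers_twist D h hx_j hx_v
    have hdvd : 2 * n ∣ 2 * 2 * p ^ k' := by rw [← D.hord]; exact orderOf_dvd_of_pow_eq_one hx1
    rw [h2n] at hdvd
    have hlt' : 2 * 2 * p ^ k' < 2 * 2 * p ^ k' * p := lt_mul_of_one_lt_right (by positivity) hp.one_lt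
    exact absurd (Nat.le_of_dvd (by positivity) hdvd) (not_le.mpr hlt')
  · have : i = k := le_antisymm hik hge
    rw [hji, this]

omit [DecidableEq G] [NeZero n] in
/-- At level `n = 2pᵏ` the mixed side is at the octic level `n = 2·orderOf u^{r+1}`. [folklore] -/
theorem octic_of_prime_pow {p k : ℕ} (hp : p.Prime) (hn : n = 2 * p ^ k)
    (h : c ∉ Subgroup.zpowers (D.u ^ (D.r + 1))) (hv : D.u ^ (D.r + 1) ≠ 1) : n = 2 * orderOf (D.u ^ (D.r + 1)) := by
  rw [orderOf_twist_eq_of_prime_pow D hp hn h hv]; exact hn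

/-! ## §3 The law at level `n = 2pᵏ`, every twist -/

omit [NeZero n] in
/-- `2pᵏ` is even (file-local). -/
private theorem even_two_mul_pow {p k : ℕ} (hn : n = 2 * p ^ k) : Even n := ⟨p ^ k, by rw [hn]; ring⟩

include D in
/-- **THE INDEX-TWO CYCLIC LAW AT LEVEL `n = 2pᵏ`, EVERY TWIST: `μ(G, c) = φ₂(G, c)`** (`p` prime; `G ≅ ℤ/4pᵏ ⋊_r ℤ/2` for any `r`).
[folklore] -/
theorem isLeast_card_gfaces_generate_fibreTwo_of_two_mul_prime_pow (hc2 : c * c = 1) (hc1 : c ≠ 1) {p k : ℕ} (hp : p.Prime)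
    (hn : n = 2 * p ^ k) :
    IsLeast {m : ℕ | ∃ S : Finset (CMF G c →₀ ℤ), ↑S ⊆ gfaceSet G c hc2 ∧ S.card = m ∧
      hodgeSpan c hc2 ≤ Submodule.span ℤ (pairSet c) ⊔ Submodule.span ℤ (translates c S)} (fibreTwo c hc2) :=
  isLeast_card_gfaces_generate_fibreTwo_of_le_octic D hc2 hc1 (even_two_mul_pow hn) (octic_of_prime_pow D hp hn)

/-- **Block currency at level `n = 2pᵏ`: `μ = β − (1 if c ∈ ⟨u^{r+1}⟩ else 2)`.** [folklore] -/
theorem isLeast_card_gfaces_generate_of_two_mul_prime_pow (hc2 : c * c = 1) (hc1 : c ≠ 1) {p k : ℕ} (hp : p.Prime)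
    (hn : n = 2 * p ^ k) :
    IsLeast {m : ℕ | ∃ S : Finset (CMF G c →₀ ℤ), ↑S ⊆ gfaceSet G c hc2 ∧ S.card = m ∧
      hodgeSpan c hc2 ≤ Submodule.span ℤ (pairSet c) ⊔ Submodule.span ℤ (translates c S)}
      (Fintype.card (Block c) - if c ∈ Subgroup.zpowers (D.u ^ (D.r + 1)) then 1 else 2) :=
  isLeast_card_gfaces_generate_of_le_octic D hc2 hc1 (even_two_mul_pow hn) (octic_of_prime_pow D hp hn)

omit [NeZero n] in
/-- **STRUCTURE-FREE FORM**: `u` of order `4pᵏ` (`p` prime) with `[G : ⟨u⟩] = 2`, `c = u^{2pᵏ}`, `c² = 1 ≠ c`, an involution `w ∉ ⟨u⟩` ⟹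
`μ(G, c) = φ₂(G, c)`. [folklore] -/
theorem isLeast_card_gfaces_generate_fibreTwo_of_involution_two_mul_prime_pow [NeZero n] (u w : G) (hun : u ^ n = c) (hord : orderOf u = 2 * n)
    (hindex : (Subgroup.zpowers u).index = 2) (hw : w ∉ Subgroup.zpowers u) (hww : w * w = 1) (hc2 : c * c = 1) (hc1 : c ≠ 1) {p k : ℕ}
    (hp : p.Prime) (hn : n = 2 * p ^ k) :
    IsLeast {m : ℕ | ∃ S : Finset (CMF G c →₀ ℤ), ↑S ⊆ gfaceSet G c hc2 ∧ S.card = m ∧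
      hodgeSpan c hc2 ≤ Submodule.span ℤ (pairSet c) ⊔ Submodule.span ℤ (translates c S)} (fibreTwo c hc2) := by
  obtain ⟨D, -, -⟩ := exists_datum_of_involution (c := c) u w hun hord hindex hw hww
  exact isLeast_card_gfaces_generate_fibreTwo_of_two_mul_prime_pow D hc2 hc1 hp hn

end

end Summit.HodgeConjecture.CorCM.Census.IndexTwoCyclic
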